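import Summits.CriticalPhenomena.PercolationContinuityZ3.Theorems.PercNearOneGluingNoHeavyLowerTailSahiCombFiveUpSetRank

/-!
# The four-chain rank lemma (the anti-nested analogue of RANK-Z): kernel form

Support file of the one-cut programme (crux `NoHeavyLowerTail`, stmt-CriticalPhenomena-4575; cell `prim-masterthm`, seat P5 gen 16;
report `P5-LORENTZIAN-TEST.md` §20, memo `FROM-prim-masterthm-p5-g16-FOUR-CHAIN-RANK.md`).

Background.  The five-up-set inequality (`FiveUpSet.fiveUpSetIneq_holds`, prim-lf-1 gen 17) is the statement, for two FLAGS of up-sets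
`Φ₀ ⊆ Φ₁`, `Γ₀ ⊆ Γ₁` of a finite cube and every up-set `P`, that the antipodal SHELL `refl((Φ₁ \ Φ₀) ∩ (Γ₁ \ Γ₀))` is dominated inside `P`:
`#(P ∩ refl Sh) ≤ #(P ∩ Sh) + Kl_P(Φ₁;Γ₀) + Kl_P(Γ₁;Φ₀)`; its proof is the rank statement RANK-Z (`rankZ_kernel_eq_zero`).  The open
`a = 2` case of the triangle functional (`FiveUpSet.TriWIneq`, `…SahiCombTriWGeneral`) has, on its ANTI-NESTED stratum
(`F {a} ⊆ F {b}` and `G {b} ⊆ G {a}`), the Kleitman–shell normal form `TRI_W(2) = 8 Kleitman gaps + 2·#(P ∩ Σ') − #(P ∩ refl Σ')` with the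
shell weight supported on `Σ' := [(Φ₃ \ Φ₀) ∩ (Γ₃ \ Γ₀)] \ [(Φ₂ \ Φ₁) ∩ (Γ₂ \ Γ₁)]` for the two CHAINS `Φ₀ ⊆ Φ₁ ⊆ Φ₂ ⊆ Φ₃ = (F ∅, F{a}, F{b}, F univ)`,
`Γ₀ ⊆ Γ₁ ⊆ Γ₂ ⊆ Γ₃ = (G ∅, G{b}, G{a}, G univ)` — eight of the nine blocks of the `3 × 3` grid of layer intersections (report §20.2).
This file proves the four-chain analogue of RANK-Z found in gen 16 (census-clean as an inequality: exhaustive `n = 2`, 24.8 M sampled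
tests `n ≤ 5`; as a `{0,1}` rank design: 600 random `n = 3` and 150 random `n = 4` chain pairs, full row rank):

**(AN♯1)**  `#(P ∩ refl Σ') + #(P ∩ Φ₃ ∩ refl Γ₀) + #(P ∩ Γ₃ ∩ refl Φ₀) + #(P ∩ Φ₃ ∩ refl Γ₂) + #(P ∩ Γ₃ ∩ refl Φ₂)`
`≤ #(P ∩ V₁) + #(P ∩ V₂) + #(P ∩ V₃) + #(P ∩ V₄)`, with the NESTED supply chain
`V₁ = Φ₃ ∩ Γ₃ ⊇ V₂ = (Φ₂ ∩ Γ₃) ∪ (Φ₃ ∩ Γ₂) ⊇ V₃ = (Φ₁ ∩ Γ₂) ∪ (Φ₂ ∩ Γ₁) ⊇ V₄ = Φ₀ ∩ Γ₀`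
(equivalently `#(P ∩ refl Σ') ≤ #(P ∩ Σ') + Kl_P(Φ₃;Γ₀) + Kl_P(Γ₃;Φ₀) + Kl_P(Φ₃;Γ₂) + Kl_P(Γ₃;Φ₂)`, `Kl_P(A;B) = #(P ∩ A ∩ B) − #(P ∩ A ∩ refl B)`).

* **`FiveUpSet.fourChain_kernel_eq_zero`** — the RANK form at `P = ⊤`: the `{0,1}` inclusion matrix whose rows are the five demand classes
  `a = refl Σ'` (visible on `V₁`), `b = Φ₃ ∩ refl Γ₀` (on `V₁`), `c = Γ₃ ∩ refl Φ₀` (on `V₁, V₄`), `d = Φ₃ ∩ refl Γ₂` (on `V₂, V₃`),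
  `e = Γ₃ ∩ refl Φ₂` (on `V₁, V₂`) and whose columns are the four supply levels has trivial left kernel.  PROOF (all in the antipodal basis of
  `ℚ^{V₁}`, `…SahiCombFiveUpSetRank`: support lemma + C1 on the up-sets `V₁ ⊇ V₂ ⊇ V₃ ⊇ V₄`, then C1 on `Φ₀, Γ₀, Φ₂, Γ₂`): the `a`-tokens are
  their own coordinates; the coordinates of `b, c, d, e` are supported on `refl(V₁ ∩ Γ₀)`, `refl(V₁ ∩ Φ₀)`, `refl(V₁ ∩ Γ₂)`, `refl(V₁ ∩ Φ₂)`;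
  reading equation `E₁` on `V₁`, `E₁ − E₂` on `V₂` and `E₁ − E₂ + E₃` on `V₃` at the indices private to `a` kills `a` in three rounds (layers
  `Φ₃ \ Φ₂`, then `Γ₃ \ Γ₂`, then the rest) and confines the `c`-coordinates to `refl V₄`, where `E₄` kills them; the rest unwinds.
The `P`-restricted kernel form and the counting corollary (AN♯1) are in the companion file `…SahiCombFourChainIneq`.
HONEST LABEL: complete proofs, std axioms; elementary linear algebra over `ℚ`; no census input. [this work]
-/

namespace Summit.CriticalPhenomena.PercolationContinuityZ3.Theorems

namespace FiveUpSet

open Finset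

variable {α : Type*} [DecidableEq α] [Fintype α]

/-! ### (AN♯1), kernel form at `P = ⊤` -/

/-- **The four-chain rank lemma, kernel form at `P = ⊤`.**  Let `Φ₀ ⊆ Φ₁ ⊆ Φ₂ ⊆ Φ₃` and `Γ₀ ⊆ Γ₁ ⊆ Γ₂ ⊆ Γ₃` be chains of up-sets of the cube
`Finset α`, and let `ka, kb, kc, kd, ke : Finset α → ℚ` be coefficient vectors supported on the five demand classes
`a = {s : sᶜ ∈ Σ'}` (`Σ' = (Φ₃ \ Φ₀) ∩ (Γ₃ \ Γ₀)` minus `(Φ₂ \ Φ₁) ∩ (Γ₂ \ Γ₁)`), `b = {s ∈ Φ₃ : sᶜ ∈ Γ₀}`, `c = {s ∈ Γ₃ : sᶜ ∈ Φ₀}`,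
`d = {s ∈ Φ₃ : sᶜ ∈ Γ₂}`, `e = {s ∈ Γ₃ : sᶜ ∈ Φ₂}`.  If the zeta sums `Z x t = Σ_s x s [s ⊆ t]` satisfy
`E₁`: `Z ka + Z kb + Z kc + Z ke = 0` on `V₁ = Φ₃ ∩ Γ₃`, `E₂`: `Z kd + Z ke = 0` on `V₂ = (Φ₂ ∩ Γ₃) ∪ (Φ₃ ∩ Γ₂)`,
`E₃`: `Z kd = 0` on `V₃ = (Φ₁ ∩ Γ₂) ∪ (Φ₂ ∩ Γ₁)` and `E₄`: `Z kc = 0` on `V₄ = Φ₀ ∩ Γ₀`, then all five vectors vanish.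
(The rows of the levelled inclusion matrix demands × supplies are linearly independent.) [this work] -/
theorem fourChain_kernel_eq_zero (Φ₀ Φ₁ Φ₂ Φ₃ Γ₀ Γ₁ Γ₂ Γ₃ : Finset (Finset α))
    (hΦ₀ : IsUpperSet (Φ₀ : Set (Finset α))) (hΦ₁ : IsUpperSet (Φ₁ : Set (Finset α)))
    (hΦ₂ : IsUpperSet (Φ₂ : Set (Finset α))) (hΦ₃ : IsUpperSet (Φ₃ : Set (Finset α)))
    (hΓ₀ : IsUpperSet (Γ₀ : Set (Finset α))) (hΓ₁ : IsUpperSet (Γ₁ : Set (Finset α)))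
    (hΓ₂ : IsUpperSet (Γ₂ : Set (Finset α))) (hΓ₃ : IsUpperSet (Γ₃ : Set (Finset α)))
    (hΦ₀₁ : Φ₀ ⊆ Φ₁) (hΦ₁₂ : Φ₁ ⊆ Φ₂) (hΦ₂₃ : Φ₂ ⊆ Φ₃) (hΓ₀₁ : Γ₀ ⊆ Γ₁) (hΓ₁₂ : Γ₁ ⊆ Γ₂) (hΓ₂₃ : Γ₂ ⊆ Γ₃)
    (ka kb kc kd ke : Finset α → ℚ)
    (hka : ∀ s, ka s ≠ 0 → sᶜ ∈ Φ₃ ∧ sᶜ ∉ Φ₀ ∧ sᶜ ∈ Γ₃ ∧ sᶜ ∉ Γ₀ ∧ ¬ (sᶜ ∈ Φ₂ ∧ sᶜ ∉ Φ₁ ∧ sᶜ ∈ Γ₂ ∧ sᶜ ∉ Γ₁))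
    (hkb : ∀ s, kb s ≠ 0 → s ∈ Φ₃ ∧ sᶜ ∈ Γ₀)
    (hkc : ∀ s, kc s ≠ 0 → s ∈ Γ₃ ∧ sᶜ ∈ Φ₀)
    (hkd : ∀ s, kd s ≠ 0 → s ∈ Φ₃ ∧ sᶜ ∈ Γ₂)
    (hke : ∀ s, ke s ≠ 0 → s ∈ Γ₃ ∧ sᶜ ∈ Φ₂)
    (h1 : ∀ t, t ∈ Φ₃ → t ∈ Γ₃ →
      ∑ s, ka s * (if s ⊆ t then (1 : ℚ) else 0) + ∑ s, kb s * (if s ⊆ t then (1 : ℚ) else 0)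
        + ∑ s, kc s * (if s ⊆ t then (1 : ℚ) else 0) + ∑ s, ke s * (if s ⊆ t then (1 : ℚ) else 0) = 0)
    (h2 : ∀ t, (t ∈ Φ₂ ∧ t ∈ Γ₃) ∨ (t ∈ Φ₃ ∧ t ∈ Γ₂) →
      ∑ s, kd s * (if s ⊆ t then (1 : ℚ) else 0) + ∑ s, ke s * (if s ⊆ t then (1 : ℚ) else 0) = 0)
    (h3 : ∀ t, (t ∈ Φ₁ ∧ t ∈ Γ₂) ∨ (t ∈ Φ₂ ∧ t ∈ Γ₁) → ∑ s, kd s * (if s ⊆ t then (1 : ℚ) else 0) = 0)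
    (h4 : ∀ t, t ∈ Φ₀ → t ∈ Γ₀ → ∑ s, kc s * (if s ⊆ t then (1 : ℚ) else 0) = 0) :
    (∀ s, ka s = 0) ∧ (∀ s, kb s = 0) ∧ (∀ s, kc s = 0) ∧ (∀ s, kd s = 0) ∧ (∀ s, ke s = 0) := by
  -- the four supply up-sets `W = V₁ ⊇ V₂ ⊇ V₃ ⊇ V₄`
  have hW : IsUpperSet ((Φ₃ ∩ Γ₃ : Finset (Finset α)) : Set (Finset α)) := by
    rw [coe_inter]; exact hΦ₃.inter hΓ₃
  have hV₂ : IsUpperSet ((Φ₂ ∩ Γ₃ ∪ Φ₃ ∩ Γ₂ : Finset (Finset α)) : Set (Finset α)) := by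
    rw [coe_union, coe_inter, coe_inter]; exact (hΦ₂.inter hΓ₃).union (hΦ₃.inter hΓ₂)
  have hV₃ : IsUpperSet ((Φ₁ ∩ Γ₂ ∪ Φ₂ ∩ Γ₁ : Finset (Finset α)) : Set (Finset α)) := by
    rw [coe_union, coe_inter, coe_inter]; exact (hΦ₁.inter hΓ₂).union (hΦ₂.inter hΓ₁)
  have hV₄ : IsUpperSet ((Φ₀ ∩ Γ₀ : Finset (Finset α)) : Set (Finset α)) := by
    rw [coe_inter]; exact hΦ₀.inter hΓ₀
  -- antipodal-basis coordinates of every zeta function on `W` (support lemma)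
  choose cf hcδ hcsupp hcid using fun s => exists_support_coef hW s
  -- the transfer identity: a combination of zeta functions, re-expanded in the coordinates, has the same values on `W`
  have transfer : ∀ (x : Finset α → ℚ), ∀ t ∈ Φ₃ ∩ Γ₃,
      ∑ u, (∑ s, x s * cf s u) * (if u ⊆ t then (1 : ℚ) else 0) = ∑ s, x s * (if s ⊆ t then (1 : ℚ) else 0) := by
    intro x t ht
    calc ∑ u, (∑ s, x s * cf s u) * (if u ⊆ t then (1 : ℚ) else 0)
        = ∑ u, ∑ s, x s * (cf s u * (if u ⊆ t then (1 : ℚ) else 0)) := by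
          refine sum_congr rfl fun u _ => ?_
          rw [Finset.sum_mul]
          refine sum_congr rfl fun s _ => ?_
          ring
      _ = ∑ s, ∑ u, x s * (cf s u * (if u ⊆ t then (1 : ℚ) else 0)) := Finset.sum_comm
      _ = ∑ s, x s * ∑ u, cf s u * (if u ⊆ t then (1 : ℚ) else 0) := by
          refine sum_congr rfl fun s _ => ?_
          rw [Finset.mul_sum]
      _ = ∑ s, x s * (if s ⊆ t then (1 : ℚ) else 0) := by
          refine sum_congr rfl fun s _ => ?_
          rw [← hcid s t ht]
  -- coordinate vectors of the four expanded classes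
  obtain ⟨Bco, hBco⟩ : ∃ f : Finset α → ℚ, ∀ u, f u = ∑ s, kb s * cf s u := ⟨_, fun _ => rfl⟩
  obtain ⟨Cco, hCco⟩ : ∃ f : Finset α → ℚ, ∀ u, f u = ∑ s, kc s * cf s u := ⟨_, fun _ => rfl⟩
  obtain ⟨Dco, hDco⟩ : ∃ f : Finset α → ℚ, ∀ u, f u = ∑ s, kd s * cf s u := ⟨_, fun _ => rfl⟩
  obtain ⟨Eco, hEco⟩ : ∃ f : Finset α → ℚ, ∀ u, f u = ∑ s, ke s * cf s u := ⟨_, fun _ => rfl⟩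
  -- the `a`-class is its own coordinate vector (its sets have complements in `W`)
  have hAco : ∀ u, ∑ s, ka s * cf s u = ka u := by
    intro u
    have hterm : ∀ s, ka s * cf s u = if u = s then ka u else 0 := by
      intro s
      by_cases h0 : ka s = 0
      · rw [h0, zero_mul]
        split_ifs with hus
        · rw [hus, h0]
        · rfl
      · have hsW : sᶜ ∈ Φ₃ ∩ Γ₃ := by
          obtain ⟨x1, -, x3, -, -⟩ := hka s h0
          exact mem_inter.2 ⟨x1, x3⟩
        rw [hcδ s hsW]
        dsimp only
        split_ifs with hus
        · rw [hus, mul_one]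
        · rw [mul_zero]
    rw [Finset.sum_congr rfl fun s _ => hterm s, Finset.sum_ite_eq]
    simp
  -- supports of the coordinate vectors: a class `{s ∈ · : sᶜ ∈ X}` (`X` an up-set) has coordinates on `refl (W ∩ X)`
  have suppOf : ∀ (x : Finset α → ℚ) (X : Finset (Finset α)), IsUpperSet (X : Set (Finset α)) →
      (∀ s, x s ≠ 0 → sᶜ ∈ X) → ∀ u, (∑ s, x s * cf s u) ≠ 0 → uᶜ ∈ Φ₃ ∩ Γ₃ ∧ uᶜ ∈ X := by
    intro x X hX hx u hu
    obtain ⟨s, -, hs⟩ := Finset.exists_ne_zero_of_sum_ne_zero hu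
    obtain ⟨huW, hus⟩ := hcsupp s u (right_ne_zero_of_mul hs)
    exact ⟨huW, hX (Finset.compl_subset_compl.2 hus) (hx s (left_ne_zero_of_mul hs))⟩
  have hBsupp : ∀ u, Bco u ≠ 0 → uᶜ ∈ Φ₃ ∩ Γ₃ ∧ uᶜ ∈ Γ₀ := fun u hu =>
    suppOf kb Γ₀ hΓ₀ (fun s hs => (hkb s hs).2) u (by rwa [hBco u] at hu)
  have hCsupp : ∀ u, Cco u ≠ 0 → uᶜ ∈ Φ₃ ∩ Γ₃ ∧ uᶜ ∈ Φ₀ := fun u hu =>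
    suppOf kc Φ₀ hΦ₀ (fun s hs => (hkc s hs).2) u (by rwa [hCco u] at hu)
  have hDsupp : ∀ u, Dco u ≠ 0 → uᶜ ∈ Φ₃ ∩ Γ₃ ∧ uᶜ ∈ Γ₂ := fun u hu =>
    suppOf kd Γ₂ hΓ₂ (fun s hs => (hkd s hs).2) u (by rwa [hDco u] at hu)
  have hEsupp : ∀ u, Eco u ≠ 0 → uᶜ ∈ Φ₃ ∩ Γ₃ ∧ uᶜ ∈ Φ₂ := fun u hu =>
    suppOf ke Φ₂ hΦ₂ (fun s hs => (hke s hs).2) u (by rwa [hEco u] at hu)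
  -- killing a class from its coordinates: if the coordinates of `{s ∈ Y : sᶜ ∈ X}` vanish, C1 on `X` kills the class
  have killOf : ∀ (x : Finset α → ℚ) (X Y : Finset (Finset α)), IsUpperSet (X : Set (Finset α)) → IsUpperSet (Y : Set (Finset α)) →
      (∀ s, x s ≠ 0 → s ∈ Y ∧ sᶜ ∈ X) → (∀ t, t ∈ X → t ∈ Y → t ∈ Φ₃ ∩ Γ₃) → (∀ u, ∑ s, x s * cf s u = 0) → ∀ s, x s = 0 := by
    intro x X Y hX hY hx hXY hco
    refine eq_zero_of_zeta_sum_eq_zero hX x (fun s hs => (hx s hs).2) ?_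
    intro t htX
    by_cases htY : t ∈ Y
    · rw [← transfer x t (hXY t htX htY)]
      refine Finset.sum_eq_zero fun u _ => ?_
      rw [hco u, zero_mul]
    · refine Finset.sum_eq_zero fun s _ => ?_
      by_cases hs : x s = 0
      · rw [hs, zero_mul]
      · have hst : ¬ s ⊆ t := fun h => htY (hY h (hx s hs).1)
        rw [if_neg hst, mul_zero]
  -- the `a`-vector is supported off `Φ₀`, off `Γ₀`, inside `W`
  have hAΦ₀ : ∀ u, uᶜ ∈ Φ₀ → ka u = 0 := by
    intro u hu; by_contra h; exact (hka u h).2.1 hu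
  have hAΓ₀ : ∀ u, uᶜ ∈ Γ₀ → ka u = 0 := by
    intro u hu; by_contra h; exact (hka u h).2.2.2.1 hu
  ------------------------------------------------------------------
  -- STEP 1: `E₁` read in antipodal coordinates on `W`: `ka + Bco + Cco + Eco = 0`
  ------------------------------------------------------------------
  have hrel1 : ∀ t ∈ Φ₃ ∩ Γ₃, ∑ u, (ka u + Bco u + Cco u + Eco u) * (if u ⊆ t then (1 : ℚ) else 0) = 0 := by
    intro t ht
    have hsplit : ∑ u, (ka u + Bco u + Cco u + Eco u) * (if u ⊆ t then (1 : ℚ) else 0)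
        = ∑ s, ka s * (if s ⊆ t then (1 : ℚ) else 0) + ∑ s, kb s * (if s ⊆ t then (1 : ℚ) else 0)
          + ∑ s, kc s * (if s ⊆ t then (1 : ℚ) else 0) + ∑ s, ke s * (if s ⊆ t then (1 : ℚ) else 0) := by
      have e4 : ∀ u, ka u + Bco u + Cco u + Eco u
          = (∑ s, ka s * cf s u) + (∑ s, kb s * cf s u) + (∑ s, kc s * cf s u) + (∑ s, ke s * cf s u) := by
        intro u; rw [hAco u, hBco u, hCco u, hEco u]
      simp only [e4, add_mul, Finset.sum_add_distrib]
      rw [transfer ka t ht, transfer kb t ht, transfer kc t ht, transfer ke t ht]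
    rw [hsplit]
    exact h1 t (mem_inter.1 ht).1 (mem_inter.1 ht).2
  have hg1 : ∀ u, ka u + Bco u + Cco u + Eco u = 0 := by
    refine eq_zero_of_zeta_sum_eq_zero hW (fun u => ka u + Bco u + Cco u + Eco u) ?_ hrel1
    intro u hu
    by_contra hW'
    have x1 : ka u = 0 := by
      by_contra h
      obtain ⟨y1, -, y3, -, -⟩ := hka u h
      exact hW' (mem_inter.2 ⟨y1, y3⟩)
    have x2 : Bco u = 0 := by by_contra h; exact hW' (hBsupp u h).1
    have x3 : Cco u = 0 := by by_contra h; exact hW' (hCsupp u h).1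
    have x4 : Eco u = 0 := by by_contra h; exact hW' (hEsupp u h).1
    apply hu
    rw [x1, x2, x3, x4]; ring
  -- (1a) `ka` vanishes at indices whose complement lies outside `Φ₂` (layer `Φ₃ \ Φ₂`)
  have hA1 : ∀ u, uᶜ ∉ Φ₂ → ka u = 0 := by
    intro u hu
    by_cases hΓ : uᶜ ∈ Γ₀
    · exact hAΓ₀ u hΓ
    · have x2 : Bco u = 0 := by by_contra h; exact hΓ (hBsupp u h).2
      have x3 : Cco u = 0 := by by_contra h'; exact hu (hΦ₁₂ (hΦ₀₁ (hCsupp u h').2))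
      have x4 : Eco u = 0 := by by_contra h'; exact hu (hEsupp u h').2
      have h := hg1 u
      rw [x2, x3, x4, add_zero, add_zero, add_zero] at h
      exact h
  -- (1b) `Bco` is supported on indices with complement in `Φ₂`
  have hB1 : ∀ u, Bco u ≠ 0 → uᶜ ∈ Φ₂ := by
    intro u hu
    by_contra hΦ
    have y1 : ka u = 0 := hA1 u hΦ
    have y3 : Cco u = 0 := by by_contra h'; exact hΦ (hΦ₁₂ (hΦ₀₁ (hCsupp u h').2))
    have y4 : Eco u = 0 := by by_contra h'; exact hΦ (hEsupp u h').2
    have h := hg1 u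
    rw [y1, y3, y4, zero_add, add_zero, add_zero] at h
    exact hu h
  ------------------------------------------------------------------
  -- STEP 2: `E₁ − E₂` on `V₂`: `ka + Bco + Cco − Dco = 0`
  ------------------------------------------------------------------
  have hV₂W : ∀ t, t ∈ Φ₂ ∩ Γ₃ ∪ Φ₃ ∩ Γ₂ → t ∈ Φ₃ ∩ Γ₃ := by
    intro t ht
    rcases mem_union.1 ht with h | h
    · exact mem_inter.2 ⟨hΦ₂₃ (mem_inter.1 h).1, (mem_inter.1 h).2⟩
    · exact mem_inter.2 ⟨(mem_inter.1 h).1, hΓ₂₃ (mem_inter.1 h).2⟩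
  have hrel2 : ∀ t ∈ Φ₂ ∩ Γ₃ ∪ Φ₃ ∩ Γ₂, ∑ u, (ka u + Bco u + Cco u - Dco u) * (if u ⊆ t then (1 : ℚ) else 0) = 0 := by
    intro t ht
    have htW := hV₂W t ht
    have hsplit : ∑ u, (ka u + Bco u + Cco u - Dco u) * (if u ⊆ t then (1 : ℚ) else 0)
        = (∑ s, ka s * (if s ⊆ t then (1 : ℚ) else 0) + ∑ s, kb s * (if s ⊆ t then (1 : ℚ) else 0)
          + ∑ s, kc s * (if s ⊆ t then (1 : ℚ) else 0) + ∑ s, ke s * (if s ⊆ t then (1 : ℚ) else 0))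
          - (∑ s, kd s * (if s ⊆ t then (1 : ℚ) else 0) + ∑ s, ke s * (if s ⊆ t then (1 : ℚ) else 0)) := by
      have e4 : ∀ u, ka u + Bco u + Cco u - Dco u
          = (∑ s, ka s * cf s u) + (∑ s, kb s * cf s u) + (∑ s, kc s * cf s u) - (∑ s, kd s * cf s u) := by
        intro u; rw [hAco u, hBco u, hCco u, hDco u]
      simp only [e4, add_mul, sub_mul, Finset.sum_add_distrib, Finset.sum_sub_distrib]
      rw [transfer ka t htW, transfer kb t htW, transfer kc t htW, transfer kd t htW]
      ring
    rw [hsplit, h1 t (mem_inter.1 htW).1 (mem_inter.1 htW).2]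
    have h2t : ∑ s, kd s * (if s ⊆ t then (1 : ℚ) else 0) + ∑ s, ke s * (if s ⊆ t then (1 : ℚ) else 0) = 0 := by
      refine h2 t ?_
      rcases mem_union.1 ht with h | h
      · exact Or.inl ⟨(mem_inter.1 h).1, (mem_inter.1 h).2⟩
      · exact Or.inr ⟨(mem_inter.1 h).1, (mem_inter.1 h).2⟩
    rw [h2t]; ring
  have hg2 : ∀ u, ka u + Bco u + Cco u - Dco u = 0 := by
    refine eq_zero_of_zeta_sum_eq_zero hV₂ (fun u => ka u + Bco u + Cco u - Dco u) ?_ hrel2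
    intro u hu
    by_contra hV'
    have x1 : ka u = 0 := by
      by_contra h
      obtain ⟨-, -, y3, -, -⟩ := hka u h
      have y2 : uᶜ ∈ Φ₂ := by by_contra h'; exact h (hA1 u h')
      exact hV' (mem_union.2 (Or.inl (mem_inter.2 ⟨y2, y3⟩)))
    have x2 : Bco u = 0 := by
      by_contra h
      exact hV' (mem_union.2 (Or.inl (mem_inter.2 ⟨hB1 u h, (mem_inter.1 (hBsupp u h).1).2⟩)))
    have x3 : Cco u = 0 := by
      by_contra h
      exact hV' (mem_union.2 (Or.inl (mem_inter.2 ⟨hΦ₁₂ (hΦ₀₁ (hCsupp u h).2), (mem_inter.1 (hCsupp u h).1).2⟩)))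
    have x4 : Dco u = 0 := by
      by_contra h
      exact hV' (mem_union.2 (Or.inr (mem_inter.2 ⟨(mem_inter.1 (hDsupp u h).1).1, (hDsupp u h).2⟩)))
    apply hu
    rw [x1, x2, x3, x4]; ring
  -- (2a) `ka` vanishes at indices whose complement lies outside `Γ₂`
  have hA2 : ∀ u, uᶜ ∉ Γ₂ → ka u = 0 := by
    intro u hu
    have x2 : Bco u = 0 := by by_contra h; exact hu (hΓ₁₂ (hΓ₀₁ (hBsupp u h).2))
    have x4 : Dco u = 0 := by by_contra h; exact hu (hDsupp u h).2
    by_cases hΦ : uᶜ ∈ Φ₀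
    · exact hAΦ₀ u hΦ
    · have x3 : Cco u = 0 := by by_contra h; exact hΦ (hCsupp u h).2
      have h := hg2 u
      rw [x2, x3, x4, add_zero, add_zero, sub_zero] at h
      exact h
  -- (2b) `Cco` is supported on indices with complement in `Γ₂`
  have hC2 : ∀ u, Cco u ≠ 0 → uᶜ ∈ Γ₂ := by
    intro u hu
    by_contra hΓ
    have y1 : ka u = 0 := hA2 u hΓ
    have y2 : Bco u = 0 := by by_contra h; exact hΓ (hΓ₁₂ (hΓ₀₁ (hBsupp u h).2))
    have y4 : Dco u = 0 := by by_contra h; exact hΓ (hDsupp u h).2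
    have h := hg2 u
    rw [y1, y2, y4, zero_add, zero_add, sub_zero] at h
    exact hu h
  -- now every live `a`-index has its complement in `V₃`
  have hA3supp : ∀ u, ka u ≠ 0 → uᶜ ∈ Φ₁ ∩ Γ₂ ∪ Φ₂ ∩ Γ₁ := by
    intro u hu
    have y2 : uᶜ ∈ Φ₂ := by by_contra h'; exact hu (hA1 u h')
    have y3 : uᶜ ∈ Γ₂ := by by_contra h'; exact hu (hA2 u h')
    obtain ⟨-, -, -, -, hno⟩ := hka u hu
    by_cases hΦ₁u : uᶜ ∈ Φ₁
    · exact mem_union.2 (Or.inl (mem_inter.2 ⟨hΦ₁u, y3⟩))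
    · by_cases hΓ₁u : uᶜ ∈ Γ₁
      · exact mem_union.2 (Or.inr (mem_inter.2 ⟨y2, hΓ₁u⟩))
      · exact absurd ⟨y2, hΦ₁u, y3, hΓ₁u⟩ hno
  ------------------------------------------------------------------
  -- STEP 3: `E₁ − E₂ + E₃` on `V₃`: `ka + Bco + Cco = 0`
  ------------------------------------------------------------------
  have hV₃V₂ : ∀ t, t ∈ Φ₁ ∩ Γ₂ ∪ Φ₂ ∩ Γ₁ → t ∈ Φ₂ ∩ Γ₃ ∪ Φ₃ ∩ Γ₂ := by
    intro t ht
    rcases mem_union.1 ht with h | h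
    · exact mem_union.2 (Or.inr (mem_inter.2 ⟨hΦ₂₃ (hΦ₁₂ (mem_inter.1 h).1), (mem_inter.1 h).2⟩))
    · exact mem_union.2 (Or.inl (mem_inter.2 ⟨(mem_inter.1 h).1, hΓ₂₃ (hΓ₁₂ (mem_inter.1 h).2)⟩))
  have hrel3 : ∀ t ∈ Φ₁ ∩ Γ₂ ∪ Φ₂ ∩ Γ₁, ∑ u, (ka u + Bco u + Cco u) * (if u ⊆ t then (1 : ℚ) else 0) = 0 := by
    intro t ht
    have htV₂ := hV₃V₂ t ht
    have htW := hV₂W t htV₂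
    have hsplit : ∑ u, (ka u + Bco u + Cco u) * (if u ⊆ t then (1 : ℚ) else 0)
        = (∑ s, ka s * (if s ⊆ t then (1 : ℚ) else 0) + ∑ s, kb s * (if s ⊆ t then (1 : ℚ) else 0)
          + ∑ s, kc s * (if s ⊆ t then (1 : ℚ) else 0) + ∑ s, ke s * (if s ⊆ t then (1 : ℚ) else 0))
          - (∑ s, kd s * (if s ⊆ t then (1 : ℚ) else 0) + ∑ s, ke s * (if s ⊆ t then (1 : ℚ) else 0))
          + ∑ s, kd s * (if s ⊆ t then (1 : ℚ) else 0) := by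
      have e4 : ∀ u, ka u + Bco u + Cco u = (∑ s, ka s * cf s u) + (∑ s, kb s * cf s u) + (∑ s, kc s * cf s u) := by
        intro u; rw [hAco u, hBco u, hCco u]
      simp only [e4, add_mul, Finset.sum_add_distrib]
      rw [transfer ka t htW, transfer kb t htW, transfer kc t htW]
      ring
    rw [hsplit, h1 t (mem_inter.1 htW).1 (mem_inter.1 htW).2]
    have h2t : ∑ s, kd s * (if s ⊆ t then (1 : ℚ) else 0) + ∑ s, ke s * (if s ⊆ t then (1 : ℚ) else 0) = 0 := by
      refine h2 t ?_
      rcases mem_union.1 htV₂ with h | h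
      · exact Or.inl ⟨(mem_inter.1 h).1, (mem_inter.1 h).2⟩
      · exact Or.inr ⟨(mem_inter.1 h).1, (mem_inter.1 h).2⟩
    have h3t : ∑ s, kd s * (if s ⊆ t then (1 : ℚ) else 0) = 0 := by
      refine h3 t ?_
      rcases mem_union.1 ht with h | h
      · exact Or.inl ⟨(mem_inter.1 h).1, (mem_inter.1 h).2⟩
      · exact Or.inr ⟨(mem_inter.1 h).1, (mem_inter.1 h).2⟩
    rw [h2t, h3t]; ring
  have hg3 : ∀ u, ka u + Bco u + Cco u = 0 := by
    refine eq_zero_of_zeta_sum_eq_zero hV₃ (fun u => ka u + Bco u + Cco u) ?_ hrel3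
    intro u hu
    by_contra hV'
    have x1 : ka u = 0 := by by_contra h; exact hV' (hA3supp u h)
    have x2 : Bco u = 0 := by
      by_contra h
      exact hV' (mem_union.2 (Or.inr (mem_inter.2 ⟨hB1 u h, hΓ₀₁ (hBsupp u h).2⟩)))
    have x3 : Cco u = 0 := by
      by_contra h
      exact hV' (mem_union.2 (Or.inl (mem_inter.2 ⟨hΦ₀₁ (hCsupp u h).2, hC2 u h⟩)))
    apply hu
    rw [x1, x2, x3]; ring
  -- (3a) `ka = 0`
  have hkazero : ∀ u, ka u = 0 := by
    intro u
    by_contra h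
    obtain ⟨-, y0, -, z0, -⟩ := hka u h
    have x2 : Bco u = 0 := by by_contra h'; exact z0 (hBsupp u h').2
    have x3 : Cco u = 0 := by by_contra h'; exact y0 (hCsupp u h').2
    have hh := hg3 u
    rw [x2, x3, add_zero, add_zero] at hh
    exact h hh
  -- (3b) `Cco` is supported on `refl V₄`
  have hC3 : ∀ u, Cco u ≠ 0 → uᶜ ∈ Φ₀ ∩ Γ₀ := by
    intro u hu
    refine mem_inter.2 ⟨(hCsupp u hu).2, ?_⟩
    by_contra hΓ
    have y2 : Bco u = 0 := by by_contra h'; exact hΓ (hBsupp u h').2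
    have hh := hg3 u
    rw [hkazero u, y2, zero_add, zero_add] at hh
    exact hu hh
  ------------------------------------------------------------------
  -- STEP 4: C1 on `V₄` with `E₄` kills `Cco`; C1 on `Φ₀` kills `kc`
  ------------------------------------------------------------------
  have hCzero : ∀ u, Cco u = 0 := by
    refine eq_zero_of_zeta_sum_eq_zero hV₄ Cco hC3 ?_
    intro t ht
    have htW : t ∈ Φ₃ ∩ Γ₃ :=
      mem_inter.2 ⟨hΦ₂₃ (hΦ₁₂ (hΦ₀₁ (mem_inter.1 ht).1)), hΓ₂₃ (hΓ₁₂ (hΓ₀₁ (mem_inter.1 ht).2))⟩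
    rw [Finset.sum_congr rfl fun u _ => by rw [hCco u], transfer kc t htW]
    exact h4 t (mem_inter.1 ht).1 (mem_inter.1 ht).2
  have hkczero : ∀ s, kc s = 0 :=
    killOf kc Φ₀ Γ₃ hΦ₀ hΓ₃ hkc (fun t ht ht' => mem_inter.2 ⟨hΦ₂₃ (hΦ₁₂ (hΦ₀₁ ht)), ht'⟩) (fun u => by rw [← hCco u]; exact hCzero u)
  ------------------------------------------------------------------
  -- STEP 5: `Bco = 0`, then C1 on `Γ₀` kills `kb`
  ------------------------------------------------------------------
  have hBzero : ∀ u, Bco u = 0 := by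
    intro u; have hh := hg3 u; rwa [hkazero u, hCzero u, zero_add, add_zero] at hh
  have hkbzero : ∀ s, kb s = 0 :=
    killOf kb Γ₀ Φ₃ hΓ₀ hΦ₃ hkb (fun t ht ht' => mem_inter.2 ⟨ht', hΓ₂₃ (hΓ₁₂ (hΓ₀₁ ht))⟩) (fun u => by rw [← hBco u]; exact hBzero u)
  ------------------------------------------------------------------
  -- STEP 6: `Eco = 0`, then C1 on `Φ₂` kills `ke`
  ------------------------------------------------------------------
  have hEzero : ∀ u, Eco u = 0 := by
    intro u; have hh := hg1 u; rwa [hkazero u, hBzero u, hCzero u, zero_add, zero_add, zero_add] at hh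
  have hkezero : ∀ s, ke s = 0 :=
    killOf ke Φ₂ Γ₃ hΦ₂ hΓ₃ hke (fun t ht ht' => mem_inter.2 ⟨hΦ₂₃ ht, ht'⟩) (fun u => by rw [← hEco u]; exact hEzero u)
  ------------------------------------------------------------------
  -- STEP 7: `Dco = 0`, then C1 on `Γ₂` kills `kd`
  ------------------------------------------------------------------
  have hDzero : ∀ u, Dco u = 0 := by
    intro u; have hh := hg2 u; rw [hkazero u, hBzero u, hCzero u, zero_add, zero_add, zero_sub] at hh
    exact neg_eq_zero.1 hh
  have hkdzero : ∀ s, kd s = 0 :=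
    killOf kd Γ₂ Φ₃ hΓ₂ hΦ₃ hkd (fun t ht ht' => mem_inter.2 ⟨ht', hΓ₂₃ ht⟩) (fun u => by rw [← hDco u]; exact hDzero u)
  exact ⟨hkazero, hkbzero, hkczero, hkdzero, hkezero⟩

end FiveUpSet

end Summit.CriticalPhenomena.PercolationContinuityZ3.Theorems
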